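import Summits.QuantumFields.YangMills.Theorems.BalabanUVNodesN15TwoSpacingGluingCurvedKnitSmallFieldNode
import Summits.QuantumFields.YangMills.Theorems.BalabanUVNodesN15PerCubeGreenNamedInverse
import Summits.QuantumFields.YangMills.Theorems.BalabanUVNodesN15CovariantTwoGridPullback
import Literature.MathematicalPhysics.QuantumFieldTheory.Balaban1983to89.B11Reg910Classes
import HarnessLib

/-!
# N15 = NE2, road (c) — PROGRAMME (PC), (PC-E-N): THE NODE OBJECTS OF THE NAMED SCALAR COVARIANT GREEN's FUNCTION FAMILY ON THE PRINTED PER-CUBE CLASS — the index, the UNITARY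
# per-cube-class carrier (`Reg335 c α₀ U′` := unitarity ∧ ONE [B11] Thm 1 (9)–(10) datum `Reg910Cube` per cube at `C = C₄ = c·M·α₀`, `ξ = 1`, on the five-block collars), the
# straight-holonomy η-pairing, the realised paired instance (`M = L^m` LIVE) and the kernel family whose ENTRIES 0 AND 3 are the two-grid η-defects of THE named inverses
# `(Δ_{R_U} + aQ′_TᵀQ′_T)⁻¹` (n15-c∕388) and of `Δ_{R_U}∘(Δ_{R_U} + aQ′_TᵀQ′_T)⁻¹` (dag-n15-c g35, n15-c∕397)

Cell `pub-ymgap`, seat `pub-ymgap-dag-n15-c` (generation g35; R134 (a) seat, strategy s1 «first missing estimate»; HUMAN RULING D-0062; chair R424 venue).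
`bears_on: R4∕N15 · K3⁸ SpineGivenEndpointR13SepCoPHV (stmt-QuantumFields-27366)`; filed `--kind definition --supports stmt-QuantumFields-27366 --as helper` — COUNT-NEUTRAL
(definitions: reviewed ∕ async-audit lane).  Structures ∕ definitions + `rfl` lemmas; 0 `sorry`, 0 `instance`.  Imports BY NAME dag-n15-c g16 FILE 132 `…CurvedKnitSmallFieldNode` (`SfIdx`,
`sfGeo` = the SIZED unit-torus carrier `unitTorusGeoS … (L^m)`, `sfGeo_len`, `sfGeo_rateFactor`, `hasMaj_unitTorusGeoS`; through FILE 131 n15-b `opGeo`∕`opFamily`∕`fineGeo`, FILE 24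
`bgInstanceM₂R`), n15-c∕388 `…PerCubeGreenNamedInverse` (`scGreenOp`, `scGreenOp′`; through it the (PC) site carriers `ScX`∕`ScX′`∕`scBlk`∕`scBlk′`∕`scShift(′)`, `scP(′)`, `covLapM`,
`gaugePair`, `coordMat`), dag-n15-a `…CovariantTwoGridPullback` (`ctauS`, `kingSec`, `mprod`, `mprod_one`), dag-n07-a `B11Reg910Classes` (`Reg910Cube` = [B11] Thm 1 (9)–(10) per cube AS TYPED).
Nothing in the tree is modified, no landed name re-declared; generator HOME `tools/g35/build_G.py` (the entry operators are CUT VERBATIM from n15-c∕392∕396's conclusions).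

WHAT (objects for n15-c∕398's `NE2PlusOperator` readout of n15-c∕392 (entry 0) and n15-c∕396 (entry 3)):
* `PcIdx d L` — the index of the family: cube ∕ volume scale `m` (doubled torus `2L·L^m`, cubes of King's cover of side `L·L^m`, [B9] size parameter `M = L^m`), the coarse run's `k ≥ 1`
  scales, the fine run's `r ≥ 1` extra scales; `PcIdx.toSf` forgets `r ≥ 1` (so `pcGeo hL i := sfGeo d hL i.toSf`, and FILE 132's carrier lemmas apply verbatim);
* `pcBgC` — the COARSE carrier: plain matrix bond fields on the coarse (PC) sites; its class predicates record unitarity only — INERT (the NE2⁺ block reads the FINE carrier's class);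
* `pcBgF … c₄r β₀` — ★ THE FINE CARRIER: `U(m)ˣ`-valued bond fields `U′` on the fine (PC) sites; `Reg335 c α₀ U′` := «every `U′_μ(x′)` is unitary» ∧ «for every cube `k` of King's cover ONE
  `B11Reg910Classes.Reg910Cube (· + e′_μ) U′ η′ (five-block collar of the plateau of k) 1 (η′·|·−·|_{T′,∞}) (c·M·α₀) (c₄r·c·M·α₀) β₀` datum» — (3.35) per cube AS PRINTED («for an arbitrary
  cube □ of the class there exists a gauge … |A| < O(1)Mα₀(L^jη)^{−1}, |∇^ηA| < O(1)Mα₀(L^jη)^{−2}», `L^jη = 1` at the unit scale, `O(1) = c`) TOGETHER WITH [B11] Thm 1's Hölder member (9)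
  (exponent `β₀`, constant `c₄r·c·M·α₀`) and (10), as the node's producers (N04∕N07) state them; `Reg336` := the same (the datum contains (10) ⊇ (3.36)); (3.37)–(3.38) inert;
* `pcPairing` — the η-pairing (NOT PRINTED data): scale shift `r`, identity on sites, test functions pulled back along King's block map `π`, backgrounds transported by the STRAIGHT
  HOLONOMY along King's block lines `U_μ(y) = Π_{t<L^r} U′_μ(σy + te′_μ)` (`avg_one`: `mprod_one`);
* `pcInstance` — the realised paired instance at index `i` (FILE 24 `bgInstanceM₂R` over the sized carrier: THE GUARD `M₅ ≤ M = L^m` IS LIVE, `pcInstance_gf_M`, unbounded);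
* `pcEntry0` ∕ `pcEntry3` — ENTRY 0: `𝔇_{τ_{Ad∘U′}}(scGreenOp′ … U′, scGreenOp … U)`; ENTRY 3: `𝔇_{τ_{Ad∘U′}}(Δ_{R_U′}∘scGreenOp′ … U′, Δ_{R_U}∘scGreenOp … U)` — n15-c∕392∕396's operators VERBATIM
  at King's masses `a_K(a₀,L,·)·n^{d+1}`; `pcOps E` ∕ `pcFamily E` — entries 0, 3 these, entries 1, 2 the consumer's `E 1`, `E 2` (the gradient entries' two-grid jet editions are NOT in the
  tree; they stay displayed in n15-c∕398); unfolding lemmas.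

HONEST FRAMING ∕ LIMITS.  Plumbing only (structures + `rfl` lemmas); MODEL carriers ∕ class ∕ pairing ∕ operators as in the (PC) chain (King's doubled-torus cover model, one cube scale
`ξ = 1`, the (3.35) constant tied to the size parameter `M = L^m` of the cover's cubes); nothing of [B9]∕[B11] asserted; NE2⁺ NOT PRINTED, NOT proved; N15 of record untouched (DISCHARGED AS
CONSUMED, p687738); K3⁸ OPEN; counts of record UNMOVED (typed 28∕28 · discharged 8∕27); one finite 𝕋⁴ at fixed ε per index — NOT infinite volume, NOT OS on ℝ⁴, NOT a mass gap, NOT Clay.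
Restate-immune (no Theses import).
-/

set_option autoImplicit false

noncomputable section

open scoped BigOperators Matrix Matrix.Norms.L2Operator

namespace Summit.QuantumFields.YangMills.BalabanUVNodes.N15.Gluing

open Literature.MathematicalPhysics.QuantumFieldTheory.Balaban1983to89
open Literature.MathematicalPhysics.QuantumFieldTheory.Balaban1983to89.B5Prop11Plancherel (Tor fine unitVec)
open Literature.MathematicalPhysics.QuantumFieldTheory.Balaban1983to89.T4EtaRate (PairedInstance EtaPairing)
open Literature.MathematicalPhysics.QuantumFieldTheory.Balaban1983to89.T4EtaRateDefect (idef)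
open Literature.MathematicalPhysics.QuantumFieldTheory.Balaban1983to89.T4EtaRateCoeffDefect (pull)
open Literature.MathematicalPhysics.QuantumFieldTheory.Balaban1983to89.B11SectG (BlockNorm)
open Literature.MathematicalPhysics.QuantumFieldTheory.Balaban1983to89.B6UnitTorusCarrier (unitTorusGeo)
open Literature.MathematicalPhysics.QuantumFieldTheory.King1986 (aK)
open Literature.MathematicalPhysics.QuantumFieldTheory.King1986.Torus (tdistT)
open Summit.QuantumFields.YangMills.BalabanUVNodes.N15.BackgroundLayer (covLapM fineGeo bgInstanceM₂R abs_le_iSup_abs)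
open Summit.QuantumFields.YangMills.BalabanUVNodes.N15.VectorPiece (kingPr unitTorusGeoS)
open Summit.QuantumFields.YangMills.BalabanUVNodes.N15.MatrixSpecies (coordMat liftMap liftBlk)
open Summit.QuantumFields.YangMills.BalabanUVNodes.N15.CurvedSpecies (gaugePair)
open Summit.QuantumFields.YangMills.BalabanUVNodes.N15.CovAvg (mprod mprod_one kingSec ctauS)
open Summit.QuantumFields.YangMills.BalabanUVNodes.N15.OperatorReadout (opGeo opFamily)

variable {d : ℕ}

/-! ## §1 The index and the sized carrier -/

section Index

/-- THE INDEX of the named Green's function family on the (PC) carriers: cube ∕ volume scale `m` (doubled torus `2L·L^m`; [B9] size parameter `M = L^m`), the coarse run's `k ≥ 1`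
scales, the fine run's `r ≥ 1` extra scales. [cite: Balaban1985BackgroundPropagators, Thm 3.1 p.397 («for M ≥ M₁»: the size parameter)] -/
structure PcIdx (d L : ℕ) : Type where
  /-- cube ∕ volume scale: size parameter `M = L^m` -/
  mv : ℕ
  /-- number of scales of the coarse run -/
  kk : ℕ
  /-- extra scales of the fine run -/
  r : ℕ
  /-- `k ≥ 1` -/
  one_le_kk : 1 ≤ kk
  /-- `r ≥ 1` -/
  one_le_r : 1 ≤ r

variable (d) {L : ℕ} [NeZero L]

/-- Forget `r ≥ 1`: the g16 index with the same `(m, k, r)`. [folklore] -/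
def PcIdx.toSf (i : PcIdx d L) : SfIdx d L := ⟨i.mv, i.kk, i.r, i.one_le_kk⟩

/-- THE SIZED CARRIER of the index (FILE 131's `sfGeo` at `i.toSf`: the unit-torus carrier of the doubled torus `2L·L^m` at `k` scales, size parameter `M = L^m`). [cite: Balaban1985BackgroundPropagators, Thm 3.1 p.397 (the size parameter)] -/
abbrev pcGeo (hL : Odd L ∧ 1 < L) (i : PcIdx d L) : B6.Geometry := sfGeo d hL i.toSf

/-- `L ≠ 0` on the carrier. [folklore] -/
theorem pcGeo_L_ne_zero (hL : Odd L ∧ 1 < L) (i : PcIdx d L) : (pcGeo d hL i).L ≠ 0 := Nat.cast_ne_zero.mpr (NeZero.ne L)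

end Index

/-! ## §2 The background carriers and the straight-holonomy pairing -/

section Carrier

variable (d) (L : ℕ) [NeZero L] (mm : Type) [Fintype mm] [DecidableEq mm]

/-- THE COARSE CARRIER: plain `M_m(ℂ)`-valued bond fields on the coarse (PC) sites; `one := 1`, `mul` pointwise; the class predicates record unitarity only and are INERT for the node
(the NE2⁺ quantifier block reads the FINE carrier's (3.35)); (3.37)–(3.38) inert. [cite: Balaban1985BackgroundPropagators, (3.35)–(3.38) p.396 (shape)] -/
def pcBgC (mv kk : ℕ) (hL : Odd L ∧ 1 < L) : B9.Backgrounds where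
  Cfg := Fin (d + 1) → ScX d L mv kk hL → Matrix mm mm ℂ
  one := fun _ _ => 1
  mul := fun U V μ x => U μ x * V μ x
  Reg335 := fun _ _ U => ∀ μ x, (U μ x)ᴴ * U μ x = 1
  Reg336 := fun _ _ U => ∀ μ x, (U μ x)ᴴ * U μ x = 1
  Cplx337 := fun _ _ _ => True
  Cplx338 := fun _ _ _ => True

/-- ★ **THE UNITARY PER-CUBE-CLASS CARRIER** on the fine (PC) sites: `U(m)ˣ`-valued bond fields `U′`; `Reg335 c α₀ U′` := «every `U′_μ(x′)` unitary» ∧ «for every cube `k` of King's cover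
ONE `B11Reg910Classes.Reg910Cube` datum ([B11] Thm 1 (9)–(10) per cube AS TYPED by dag-n07-a) on the five-block collar of the plateau of `k`, cube scale `ξ = 1` (= `L^jη` at the unit
scale), η′-scale sup-distance, constants `C := c·M·α₀` ((3.35)'s «O(1)Mα₀(L^jη)^{−1}», `O(1) = c`), Hölder constant `C₄ := c₄r·c·M·α₀`, exponent `β₀`»; `Reg336` := the same; (3.37)–(3.38)
inert. [cite: Balaban1985BackgroundPropagators, (3.35)–(3.36) p.396; Balaban1985Variational, Thm 1 (9)–(10) p.279 (shapes)] -/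
def pcBgF (mv kk r : ℕ) (hL : Odd L ∧ 1 < L) (M c₄r β₀ : ℝ) : B9.Backgrounds where
  Cfg := Fin (d + 1) → ScX' d L mv kk r hL → (Matrix mm mm ℂ)ˣ
  one := fun _ _ => 1
  mul := fun U V μ x => U μ x * V μ x
  Reg335 := fun c α₀ U' => (∀ μ x', (U' μ x' : Matrix mm mm ℂ) ∈ Matrix.unitaryGroup mm ℂ) ∧
    ∀ k : Fin (d + 1) → ZMod (2 * L), B11Reg910Classes.Reg910Cube (scShift' d L mv kk r hL) U' ((((L ^ r * L ^ kk : ℕ) : ℝ))⁻¹) {z : ScX' d L mv kk r hL | ∃ y ∈ cvSk d L mv kk hL k, (unitTorusGeo L kk (cvM d L mv kk hL)).dist (scBlk' d L mv kk r hL z) y ≤ 5} 1 (fun z z' => ((((L ^ r * L ^ kk : ℕ) : ℝ))⁻¹) * tdistT (fine (L ^ r * L ^ kk) (cvM d L mv kk hL)) z z') (c * M * α₀) (c₄r * (c * M * α₀)) β₀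
  Reg336 := fun c α₀ U' => (∀ μ x', (U' μ x' : Matrix mm mm ℂ) ∈ Matrix.unitaryGroup mm ℂ) ∧
    ∀ k : Fin (d + 1) → ZMod (2 * L), B11Reg910Classes.Reg910Cube (scShift' d L mv kk r hL) U' ((((L ^ r * L ^ kk : ℕ) : ℝ))⁻¹) {z : ScX' d L mv kk r hL | ∃ y ∈ cvSk d L mv kk hL k, (unitTorusGeo L kk (cvM d L mv kk hL)).dist (scBlk' d L mv kk r hL z) y ≤ 5} 1 (fun z z' => ((((L ^ r * L ^ kk : ℕ) : ℝ))⁻¹) * tdistT (fine (L ^ r * L ^ kk) (cvM d L mv kk hL)) z z') (c * M * α₀) (c₄r * (c * M * α₀)) β₀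
  Cplx337 := fun _ _ _ => True
  Cplx338 := fun _ _ _ => True

/-- Unfolding of the fine carrier's (3.35). [folklore] -/
theorem reg335_pcBgF_iff (mv kk r : ℕ) (hL : Odd L ∧ 1 < L) (M c₄r β₀ c α₀ : ℝ) (U' : Fin (d + 1) → ScX' d L mv kk r hL → (Matrix mm mm ℂ)ˣ) :
    (pcBgF d L mm mv kk r hL M c₄r β₀).Reg335 c α₀ U' ↔
      (∀ μ x', (U' μ x' : Matrix mm mm ℂ) ∈ Matrix.unitaryGroup mm ℂ) ∧
        ∀ k : Fin (d + 1) → ZMod (2 * L), B11Reg910Classes.Reg910Cube (scShift' d L mv kk r hL) U' ((((L ^ r * L ^ kk : ℕ) : ℝ))⁻¹) {z : ScX' d L mv kk r hL | ∃ y ∈ cvSk d L mv kk hL k, (unitTorusGeo L kk (cvM d L mv kk hL)).dist (scBlk' d L mv kk r hL z) y ≤ 5} 1 (fun z z' => ((((L ^ r * L ^ kk : ℕ) : ℝ))⁻¹) * tdistT (fine (L ^ r * L ^ kk) (cvM d L mv kk hL)) z z') (c * M * α₀) (c₄r * (c * M * α₀)) β₀ := Iff.rfl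

variable {g : B6.Geometry} (ι : Type) [Fintype ι]

/-- THE η-PAIRING of the named family (NOT PRINTED data): coarse spacing `η = L^{−k}`, fine spacing `η′ = η·L^{−r}`, identity on sites, test functions pulled back along King's block map
`π`, backgrounds transported by the STRAIGHT HOLONOMY along King's block lines `(avg U′)_μ(y) = Π_{t<L^r} U′_μ(σy + te′_μ)`. [cite: King1986, p.664 (convention before Prop. 3.8); Balaban1985Averaging, (124)–(125) p.36 (pairing: shape)] -/
def pcPairing (mv kk r : ℕ) (hL : Odd L ∧ 1 < L) (hg : g.L ≠ 0) (blk : ScX d L mv kk hL → g.Site) (M c₄r β₀ : ℝ) :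
    EtaPairing (opGeo g (ScX d L mv kk hL × ι) (liftBlk blk ι)) (fineGeo g (ScX' d L mv kk r hL × ι) (liftBlk (blk ∘ kingPr L kk r (cvM d L mv kk hL)) ι) r)
      (pcBgC d L mm mv kk hL) (pcBgF d L mm mv kk r hL M c₄r β₀) where
  n := r
  k_eq := rfl
  L_eq := rfl
  M_eq := rfl
  eta_eq := by
    show g.eta * (g.L ^ r)⁻¹ * g.L ^ r = g.eta
    rw [mul_assoc, inv_mul_cancel₀ (pow_ne_zero _ hg), mul_one]
  ι := fun y => y
  scale_ι := fun _ => rfl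
  dist_ι := fun _ _ => rfl
  τ := fun lam => pull (liftMap (kingPr L kk r (cvM d L mv kk hL)) ι) lam
  suppIn_τ := fun _ _ h p hp => h (liftMap (kingPr L kk r (cvM d L mv kk hL)) ι p) hp
  supNorm_τ := fun lam => by
    show (⨆ p : ScX' d L mv kk r hL × ι, |lam (liftMap (kingPr L kk r (cvM d L mv kk hL)) ι p)|) ≤ ⨆ p : ScX d L mv kk hL × ι, |lam p|
    exact Real.iSup_le (fun p => abs_le_iSup_abs lam (liftMap (kingPr L kk r (cvM d L mv kk hL)) ι p)) (Real.iSup_nonneg fun p => abs_nonneg _)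
  avg := fun U' => (fun μ y => mprod (fun t => (U' μ (kingSec (cvM d L mv kk hL) L kk r y + t • unitVec (fine (L ^ r * L ^ kk) (cvM d L mv kk hL)) μ) : Matrix mm mm ℂ)) (L ^ r))
  avg_one := by
    funext μ y
    show mprod (fun t => (((1 : (Matrix mm mm ℂ)ˣ) : (Matrix mm mm ℂ)ˣ) : Matrix mm mm ℂ)) (L ^ r) = 1
    simp only [Units.val_one]
    exact mprod_one (L ^ r)

end Carrier

/-! ## §3 The realised instance (`M = L^m` live) -/

section Instance

variable (d) {L : ℕ} [NeZero L] (mm ι : Type) [Fintype mm] [DecidableEq mm] [Fintype ι] [DecidableEq ι] (c₄r β₀ : ℝ)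

/-- THE REALISED PAIRED INSTANCE of the index over the (PC) carriers: FILE 24's `bgInstanceM₂R` over the SIZED carrier (`M = L^m`), blocks `liftBlk scBlk ι` (coarse) and
`liftBlk (scBlk∘π) ι` (fine), the straight-holonomy pairing; the fine class constants tied to `M = L^m`. [cite: Balaban1985BackgroundPropagators, Thm 3.14 pp.426–427 (typing template); (3.35)–(3.36) p.396 (shapes)] -/
def pcInstance (hL : Odd L ∧ 1 < L) (i : PcIdx d L) : PairedInstance :=
  bgInstanceM₂R (ι := ι) (g := pcGeo d hL i) (scBlk d L i.mv i.kk hL) (kingPr L i.kk i.r (cvM d L i.mv i.kk hL)) i.r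
    (pcBgC d L mm i.mv i.kk hL) (pcBgF d L mm i.mv i.kk i.r hL ((L : ℝ) ^ i.mv) c₄r β₀)
    (pcPairing d L mm ι (g := pcGeo d hL i) i.mv i.kk i.r hL (pcGeo_L_ne_zero d hL i) (scBlk d L i.mv i.kk hL) ((L : ℝ) ^ i.mv) c₄r β₀)

omit [DecidableEq ι] in
/-- THE GUARD IS LIVE: the fine geometry's [B9] size parameter is `L^m`. [folklore] -/
theorem pcInstance_gf_M (hL : Odd L ∧ 1 < L) (i : PcIdx d L) : (pcInstance d mm ι c₄r β₀ hL i).gf.M = (L : ℝ) ^ i.mv := rfl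

omit [DecidableEq ι] in
/-- `L^m` is unbounded on the family: no bounded-`M` witness (given `k, r ≥ 1`). [folklore] -/
theorem pcInstance_gf_M_unbounded (hL : Odd L ∧ 1 < L) {kk r : ℕ} (hk : 1 ≤ kk) (hr : 1 ≤ r) (M₅ : ℝ) : ∃ i : PcIdx d L, M₅ ≤ (pcInstance d mm ι c₄r β₀ hL i).gf.M := by
  obtain ⟨m, hm⟩ := pow_unbounded_of_one_lt M₅ (by exact_mod_cast hL.2 : (1 : ℝ) < (L : ℝ))
  exact ⟨⟨m, kk, r, hk, hr⟩, hm.le⟩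

omit [DecidableEq ι] in
/-- The fine carrier's (3.35) at the instance: unitarity ∧ ONE `Reg910Cube` datum per cube at `C = c·L^m·α₀`, `C₄ = c₄r·C`, `ξ = 1`. [folklore] -/
theorem pcInstance_reg335_iff (hL : Odd L ∧ 1 < L) (i : PcIdx d L) (c α₀ : ℝ) (U' : Fin (d + 1) → ScX' d L i.mv i.kk i.r hL → (Matrix mm mm ℂ)ˣ) :
    (pcInstance d mm ι c₄r β₀ hL i).Bf.Reg335 c α₀ U' ↔
      (∀ μ x', (U' μ x' : Matrix mm mm ℂ) ∈ Matrix.unitaryGroup mm ℂ) ∧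
        ∀ k : Fin (d + 1) → ZMod (2 * L), B11Reg910Classes.Reg910Cube (scShift' d L i.mv i.kk i.r hL) U' ((((L ^ i.r * L ^ i.kk : ℕ) : ℝ))⁻¹) {z : ScX' d L i.mv i.kk i.r hL | ∃ y ∈ cvSk d L i.mv i.kk hL k, (unitTorusGeo L i.kk (cvM d L i.mv i.kk hL)).dist (scBlk' d L i.mv i.kk i.r hL z) y ≤ 5} 1 (fun z z' => ((((L ^ i.r * L ^ i.kk : ℕ) : ℝ))⁻¹) * tdistT (fine (L ^ i.r * L ^ i.kk) (cvM d L i.mv i.kk hL)) z z') (c * (L : ℝ) ^ i.mv * α₀) (c₄r * (c * (L : ℝ) ^ i.mv * α₀)) β₀ := Iff.rfl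

end Instance

/-! ## §4 Entries 0 and 3 of the NAMED Green's functions; the operators and the kernel family -/

section Family

variable (d) {L : ℕ} [NeZero L] (mm ι : Type) [Fintype mm] [DecidableEq mm] [Fintype ι] [DecidableEq ι] (a₀ : ℝ) (e : Matrix mm mm ℂ ≃L[ℝ] (ι → ℝ)) (c₄r β₀ : ℝ)

/-- **ENTRY 0 OF THE NAMED FAMILY**: the η-defect through the covariant transport `τ_{Ad∘U′}` between THE fine named Green's function `scGreenOp′ … U′ = (Δ_{R_U′} + a′Q′_TᵀQ′_T)⁻¹` (King's mass
`a_K(a₀,L,r+k)·(L^rL^k)^{d+1}`) and THE coarse one at the straight holonomies `U` of `U′` (mass `a_K(a₀,L,k)·(L^k)^{d+1}`) — n15-c∕392's operator VERBATIM. [cite: Balaban1985BackgroundPropagators, (3.42) p.397 (first entry: shape), Thm 3.14 pp.426–427 (difference template)] -/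
def pcEntry0 (hL : Odd L ∧ 1 < L) (i : PcIdx d L) (U' : Fin (d + 1) → ScX' d L i.mv i.kk i.r hL → (Matrix mm mm ℂ)ˣ) :
    (ScX d L i.mv i.kk hL × ι → ℝ) →ₗ[ℝ] (ScX' d L i.mv i.kk i.r hL × ι → ℝ) :=
  idef (ctauS (cvM d L i.mv i.kk hL) L i.kk i.r (fun μ x' => coordMat e (ContinuousLinearMap.mulLeftRight ℝ (Matrix mm mm ℂ) ((U' μ x' : Matrix mm mm ℂ)) ((U' μ x' : Matrix mm mm ℂ))ᴴ))) (ctauS (cvM d L i.mv i.kk hL) L i.kk i.r (fun μ x' => coordMat e (ContinuousLinearMap.mulLeftRight ℝ (Matrix mm mm ℂ) ((U' μ x' : Matrix mm mm ℂ)) ((U' μ x' : Matrix mm mm ℂ))ᴴ))) (scGreenOp' d L i.mv i.kk i.r hL (aK a₀ (L : ℝ) (i.r + i.kk) * (((L ^ i.r * L ^ i.kk : ℕ) : ℝ)) ^ (d + 1)) ((((L ^ i.r * L ^ i.kk : ℕ) : ℝ))⁻¹) ι e (fun μ z => (U' μ z : Matrix mm mm ℂ))) (scGreenOp d L i.mv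 i.kk hL (aK a₀ (L : ℝ) i.kk * (((L ^ i.kk : ℕ) : ℝ)) ^ (d + 1)) ((((L ^ i.kk : ℕ) : ℝ))⁻¹) ι e (fun μ y => mprod (fun t => (U' μ (kingSec (cvM d L i.mv i.kk hL) L i.kk i.r y + t • unitVec (fine (L ^ i.r * L ^ i.kk) (cvM d L i.mv i.kk hL)) μ) : Matrix mm mm ℂ)) (L ^ i.r)))

/-- **ENTRY 3 OF THE NAMED FAMILY**: the η-defect through `τ_{Ad∘U′}` between `Δ_{R_U′} ∘ scGreenOp′ … U′` and `Δ_{R_U} ∘ scGreenOp … U` — n15-c∕396's operator VERBATIM.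
[cite: Balaban1985BackgroundPropagators, (3.42) p.397 (fourth entry: shape), Thm 3.14 pp.426–427 (difference template)] -/
def pcEntry3 (hL : Odd L ∧ 1 < L) (i : PcIdx d L) (U' : Fin (d + 1) → ScX' d L i.mv i.kk i.r hL → (Matrix mm mm ℂ)ˣ) :
    (ScX d L i.mv i.kk hL × ι → ℝ) →ₗ[ℝ] (ScX' d L i.mv i.kk i.r hL × ι → ℝ) :=
  idef (ctauS (cvM d L i.mv i.kk hL) L i.kk i.r (fun μ x' => coordMat e (ContinuousLinearMap.mulLeftRight ℝ (Matrix mm mm ℂ) ((U' μ x' : Matrix mm mm ℂ)) ((U' μ x' : Matrix mm mm ℂ))ᴴ))) (ctauS (cvM d L i.mv i.kk hL) L i.kk i.r (fun μ x' => coordMat e (ContinuousLinearMap.mulLeftRight ℝ (Matrix mm mm ℂ) ((U' μ x' : Matrix mm mm ℂ)) ((U' μ x' : Matrix mm mm ℂ))ᴴ)))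
    (covLapM (scShift' d L i.mv i.kk i.r hL) ((((L ^ i.r * L ^ i.kk : ℕ) : ℝ))⁻¹) (gaugePair (scShift' d L i.mv i.kk i.r hL) (fun μ x => coordMat e (ContinuousLinearMap.mulLeftRight ℝ (Matrix mm mm ℂ) ((U' μ x : Matrix mm mm ℂ)) ((U' μ x : Matrix mm mm ℂ))ᴴ))) ∘ₗ (scGreenOp' d L i.mv i.kk i.r hL (aK a₀ (L : ℝ) (i.r + i.kk) * (((L ^ i.r * L ^ i.kk : ℕ) : ℝ)) ^ (d + 1)) ((((L ^ i.r * L ^ i.kk : ℕ) : ℝ))⁻¹) ι e (fun μ z => (U' μ z : Matrix mm mm ℂ))))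
    (covLapM (scShift d L i.mv i.kk hL) ((((L ^ i.kk : ℕ) : ℝ))⁻¹) (gaugePair (scShift d L i.mv i.kk hL) (fun μ x => coordMat e (ContinuousLinearMap.mulLeftRight ℝ (Matrix mm mm ℂ) (mprod (fun t => (U' μ (kingSec (cvM d L i.mv i.kk hL) L i.kk i.r x + t • unitVec (fine (L ^ i.r * L ^ i.kk) (cvM d L i.mv i.kk hL)) μ) : Matrix mm mm ℂ)) (L ^ i.r)) (mprod (fun t => (U' μ (kingSec (cvM d L i.mv i.kk hL) L i.kk i.r x + t • unitVec (fine (L ^ i.r * L ^ i.kk) (cvM d L i.mv i.kk hL)) μ) : Matrix mm mm ℂ)) (L ^ i.r))ᴴ))) ∘ₗ (scGreenOp d L i.mv i.kk hL (aK a₀ (L : ℝ) i.kk * (((L ^ i.kk : ℕ) : ℝ)) ^ (d + 1)) ((((L ^ i.kk : ℕ) : ℝ))⁻¹) ι e (fun μ y => mprod (fun t => (U' μ (kingSec (cvM d L i.mv i.kk hL) L i.kk i.r y + t • unitVec (fine (L ^ i.r * L ^ i.kk) (cvM d L i.mv i.kk hL)) μ) : Matrix mm mm ℂ)) (L ^ 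i.r))))

/-- THE FOUR ENTRY OPERATORS: entry 0 = `pcEntry0`, entry 3 = `pcEntry3`; entries 1–2 = the consumer's `E 1, E 2` (the gradient entries' two-grid jet editions on the per-cube class are
not in the tree). [cite: Balaban1985BackgroundPropagators, (3.42) p.397 (the four entries: shape)] -/
def pcOps (hL : Odd L ∧ 1 < L) (i : PcIdx d L)
    (E : Fin 4 → (Fin (d + 1) → ScX' d L i.mv i.kk i.r hL → (Matrix mm mm ℂ)ˣ) → ((ScX d L i.mv i.kk hL × ι → ℝ) →ₗ[ℝ] (ScX' d L i.mv i.kk i.r hL × ι → ℝ))) :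
    Fin 4 → (Fin (d + 1) → ScX' d L i.mv i.kk i.r hL → (Matrix mm mm ℂ)ˣ) → ((ScX d L i.mv i.kk hL × ι → ℝ) →ₗ[ℝ] (ScX' d L i.mv i.kk i.r hL × ι → ℝ)) :=
  fun n U' => ![pcEntry0 d mm ι a₀ e hL i U', E 1 U', E 2 U', pcEntry3 d mm ι a₀ e hL i U'] n

/-- Unfolding: entry 0. [folklore] -/
@[simp] theorem pcOps_zero (hL : Odd L ∧ 1 < L) (i : PcIdx d L)
    (E : Fin 4 → (Fin (d + 1) → ScX' d L i.mv i.kk i.r hL → (Matrix mm mm ℂ)ˣ) → ((ScX d L i.mv i.kk hL × ι → ℝ) →ₗ[ℝ] (ScX' d L i.mv i.kk i.r hL × ι → ℝ)))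
    (U' : Fin (d + 1) → ScX' d L i.mv i.kk i.r hL → (Matrix mm mm ℂ)ˣ) : pcOps d mm ι a₀ e hL i E 0 U' = pcEntry0 d mm ι a₀ e hL i U' := rfl

/-- Unfolding: entry 3. [folklore] -/
@[simp] theorem pcOps_three (hL : Odd L ∧ 1 < L) (i : PcIdx d L)
    (E : Fin 4 → (Fin (d + 1) → ScX' d L i.mv i.kk i.r hL → (Matrix mm mm ℂ)ˣ) → ((ScX d L i.mv i.kk hL × ι → ℝ) →ₗ[ℝ] (ScX' d L i.mv i.kk i.r hL × ι → ℝ)))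
    (U' : Fin (d + 1) → ScX' d L i.mv i.kk i.r hL → (Matrix mm mm ℂ)ˣ) : pcOps d mm ι a₀ e hL i E 3 U' = pcEntry3 d mm ι a₀ e hL i U' := rfl

/-- Unfolding: entries 1–2 are the consumer's. [folklore] -/
theorem pcOps_one_two (hL : Odd L ∧ 1 < L) (i : PcIdx d L)
    (E : Fin 4 → (Fin (d + 1) → ScX' d L i.mv i.kk i.r hL → (Matrix mm mm ℂ)ˣ) → ((ScX d L i.mv i.kk hL × ι → ℝ) →ₗ[ℝ] (ScX' d L i.mv i.kk i.r hL × ι → ℝ)))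
    (U' : Fin (d + 1) → ScX' d L i.mv i.kk i.r hL → (Matrix mm mm ℂ)ˣ) :
    pcOps d mm ι a₀ e hL i E 1 U' = E 1 U' ∧ pcOps d mm ι a₀ e hL i E 2 U' = E 2 U' := ⟨rfl, rfl⟩

/-- THE KERNEL FAMILY of the index (n15-b `opFamily` on the coloured (PC) site carriers: coarse blocks `liftBlk scBlk ι`, fine blocks through King's block map).
[cite: Balaban1985BackgroundPropagators, (3.42) p.397 (shape)] -/
def pcFamily (hL : Odd L ∧ 1 < L) (i : PcIdx d L)
    (E : Fin 4 → (Fin (d + 1) → ScX' d L i.mv i.kk i.r hL → (Matrix mm mm ℂ)ˣ) → ((ScX d L i.mv i.kk hL × ι → ℝ) →ₗ[ℝ] (ScX' d L i.mv i.kk i.r hL × ι → ℝ))) :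
    B9.KernelFamily (pcInstance d mm ι c₄r β₀ hL i).gc (pcInstance d mm ι c₄r β₀ hL i).Bf :=
  show B9.KernelFamily (opGeo (pcGeo d hL i) (ScX d L i.mv i.kk hL × ι) (liftBlk (scBlk d L i.mv i.kk hL) ι)) (pcBgF d L mm i.mv i.kk i.r hL ((L : ℝ) ^ i.mv) c₄r β₀) from
    opFamily (g := pcGeo d hL i) (liftBlk (scBlk d L i.mv i.kk hL) ι) (liftBlk (scBlk d L i.mv i.kk hL ∘ kingPr L i.kk i.r (cvM d L i.mv i.kk hL)) ι) (pcOps d mm ι a₀ e hL i E)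

/-- Unfolding of the entries: the sharp fine-cube sup of the entry operator applied to the test function. [folklore] -/
theorem pcFamily_e (hL : Odd L ∧ 1 < L) (i : PcIdx d L)
    (E : Fin 4 → (Fin (d + 1) → ScX' d L i.mv i.kk i.r hL → (Matrix mm mm ℂ)ˣ) → ((ScX d L i.mv i.kk hL × ι → ℝ) →ₗ[ℝ] (ScX' d L i.mv i.kk i.r hL × ι → ℝ)))
    (n : Fin 4) (U' : Fin (d + 1) → ScX' d L i.mv i.kk i.r hL → (Matrix mm mm ℂ)ˣ) (lam : ScX d L i.mv i.kk hL × ι → ℝ) (y : (pcGeo d hL i).Site) :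
    (pcFamily d mm ι a₀ e c₄r β₀ hL i E).e n U' lam y =
      (BlockNorm.ofBlocks (pcGeo d hL i) (liftBlk (scBlk d L i.mv i.kk hL ∘ kingPr L i.kk i.r (cvM d L i.mv i.kk hL)) ι)).loc y (pcOps d mm ι a₀ e hL i E n U' lam) := rfl

end Family

end Summit.QuantumFields.YangMills.BalabanUVNodes.N15.Gluing

end
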